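import Literature.Barriers.ValiantsHypothesis.BIJL18MatrixCompletion
import HarnessLib

/-!
# Bläser–Ikenmeyer–Jindal–Lysikov 2018, App. B — discharge of the example separating the two
border completion ranks

Sibling proof file of `BIJL18MatrixCompletion.lean` (val-lit t23). Proves the named fact
`BIJL2018_appB_example K`: for `A₀ = I₃`, `A₁ = E₃₁`, `A₂ = E₃₂` (the matrix
`[[1,0,0],[0,1,0],[x,y,1]]`) the weak border completion rank (only `A₀` approximated) is `2` while
`\underline{CR}(A₀, A₁, A₂) = 1` [BlaserIkenmeyerJindalLysikov2018, App. B, ECCC pp.26–27].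
The printed argument is followed: "the upper-left `2 × 2`-minor of any close-enough
approximation to this matrix will be nonzero" (`≥ 2`), "we can however bring down the rank to `2`
by substituting `y ↦ 1/ε`" (`≤ 2`, with `Ã₀ = I₃ + εE₂₃`), and the explicit approximations
`Ã₁ = εE₁₁ + E₃₁`, `Ã₂ = εE₂₂ + E₃₂`, `λ = (−1/ε, −1/ε)` giving the rank-one matrix
`[[0,0,0],[0,0,0],[−1/ε,−1/ε,1]]` (`≤ 1`); `≥ 1` because `Ã₀ = I₃ + O(ε)` is invertible over
`K(ε)` while `λ₁Ã₁ + λ₂Ã₂` has rank `≤ 2`. Also proved here: closure of `a + O(ε)`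
(`IsApproxOf`) under `+`, `·`, `−`. Theorem-only file. HONEST FRAMING: typed literature;
`VP ≠ VNP` is NOT proved.
-/

noncomputable section

namespace Literature.Barriers.ValiantsHypothesis

universe u

variable {K : Type u} [Field K]

/-! ### Closure properties of `f = a + O(ε)` -/

section Approx

/-- `0 = 0 + O(ε)`. [cite: BlaserIkenmeyerJindalLysikov2018, Def. 9] -/
theorem isApproxOf_zero : IsApproxOf (0 : K) 0 := by
  simpa using isApproxOf_C (0 : K)

/-- `1 = 1 + O(ε)`. [cite: BlaserIkenmeyerJindalLysikov2018, Def. 9] -/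
theorem isApproxOf_one : IsApproxOf (1 : K) 1 := by
  simpa using isApproxOf_C (1 : K)

/-- `ε = 0 + O(ε)`. [cite: BlaserIkenmeyerJindalLysikov2018, Def. 9] -/
theorem isApproxOf_X : IsApproxOf (0 : K) RatFunc.X :=
  ⟨by rw [RatFunc.denom_X, Polynomial.eval_one]; exact one_ne_zero, RatFunc.eval_X _ _⟩

/-- A divisor of a polynomial not vanishing at `0` does not vanish at `0`. [folklore] -/
private theorem eval_ne_zero_of_dvd {p q : Polynomial K} (hpq : p ∣ q) (hq : q.eval 0 ≠ 0) :
    p.eval 0 ≠ 0 := by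
  obtain ⟨r, rfl⟩ := hpq
  rw [Polynomial.eval_mul] at hq
  exact left_ne_zero_of_mul hq

/-- `(a + O(ε)) + (b + O(ε)) = (a + b) + O(ε)`. [cite: BlaserIkenmeyerJindalLysikov2018, Def. 9] -/
theorem IsApproxOf.add {a b : K} {f g : RatFunc K} (hf : IsApproxOf a f) (hg : IsApproxOf b g) :
    IsApproxOf (a + b) (f + g) := by
  refine ⟨eval_ne_zero_of_dvd (RatFunc.denom_add_dvd f g) ?_, ?_⟩
  · rw [Polynomial.eval_mul]; exact mul_ne_zero hf.1 hg.1
  · rw [RatFunc.eval_add _ _ hf.1 hg.1, hf.2, hg.2]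

/-- `(a + O(ε)) · (b + O(ε)) = ab + O(ε)`. [cite: BlaserIkenmeyerJindalLysikov2018, Def. 9] -/
theorem IsApproxOf.mul {a b : K} {f g : RatFunc K} (hf : IsApproxOf a f) (hg : IsApproxOf b g) :
    IsApproxOf (a * b) (f * g) := by
  refine ⟨eval_ne_zero_of_dvd (RatFunc.denom_mul_dvd f g) ?_, ?_⟩
  · rw [Polynomial.eval_mul]; exact mul_ne_zero hf.1 hg.1
  · rw [RatFunc.eval_mul _ _ hf.1 hg.1, hf.2, hg.2]

/-- `-(a + O(ε)) = -a + O(ε)`. [cite: BlaserIkenmeyerJindalLysikov2018, Def. 9] -/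
theorem IsApproxOf.neg {a : K} {f : RatFunc K} (hf : IsApproxOf a f) : IsApproxOf (-a) (-f) := by
  have h := (isApproxOf_C (-1 : K)).mul hf
  rwa [map_neg, map_one, neg_one_mul, neg_one_mul] at h

/-- `(a + O(ε)) - (b + O(ε)) = (a - b) + O(ε)`. [cite: BlaserIkenmeyerJindalLysikov2018, Def. 9] -/
theorem IsApproxOf.sub {a b : K} {f g : RatFunc K} (hf : IsApproxOf a f) (hg : IsApproxOf b g) :
    IsApproxOf (a - b) (f - g) := by
  rw [sub_eq_add_neg, sub_eq_add_neg]
  exact hf.add hg.neg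

/-- An approximation of a non-zero constant is non-zero. [cite: BlaserIkenmeyerJindalLysikov2018, Def. 9] -/
theorem IsApproxOf.ne_zero {a : K} {f : RatFunc K} (hf : IsApproxOf a f) (ha : a ≠ 0) : f ≠ 0 := by
  rintro rfl
  exact ha (by rw [← hf.2, RatFunc.eval_zero])

end Approx

/-! ### Small rank lemmas -/

section RankAux

variable {L : Type*} [Field L]

/-- Subadditivity of the rank (cf. `Literature.Computability.AlgebraicComplexity.rank_sum_le`,
not imported). [folklore] -/
private theorem rank_add_le_aux {m n : Type*} [Fintype m] [Fintype n] (A B : Matrix m n L) :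
    (A + B).rank ≤ A.rank + B.rank := by
  classical
  unfold Matrix.rank
  rw [Matrix.mulVecLin_add]
  calc Module.finrank L (LinearMap.range (A.mulVecLin + B.mulVecLin))
      ≤ Module.finrank L ↥(LinearMap.range A.mulVecLin ⊔ LinearMap.range B.mulVecLin) := by
        apply Submodule.finrank_mono
        rintro _ ⟨v, rfl⟩
        exact Submodule.add_mem_sup ⟨v, rfl⟩ ⟨v, rfl⟩
    _ ≤ _ := Submodule.finrank_add_le_finrank_add_finrank _ _

/-- Scaling does not raise the rank. [folklore] -/
private theorem rank_smul_le_aux {m n : Type*} [Fintype m] [Fintype n] [DecidableEq m] (c : L)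
    (A : Matrix m n L) : (c • A).rank ≤ A.rank := by
  have : c • A = (c • (1 : Matrix m m L)) * A := by rw [Matrix.smul_mul, Matrix.one_mul]
  rw [this]
  exact Matrix.rank_mul_le_right _ _

/-- A matrix with a non-zero entry has rank `≥ 1`. [folklore] -/
private theorem one_le_rank_of_apply_ne_zero {m n : Type*} [Fintype m] [Fintype n] (A : Matrix m n L)
    (i : m) (j : n) (h : A i j ≠ 0) : 1 ≤ A.rank := by
  have hu : IsUnit (A.submatrix ![i] ![j]) := by
    rw [Matrix.isUnit_iff_isUnit_det, Matrix.det_fin_one]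
    exact isUnit_iff_ne_zero.mpr (by simpa using h)
  calc 1 = (A.submatrix ![i] ![j]).rank := by rw [Matrix.rank_of_isUnit _ hu]; simp
    _ ≤ A.rank := Matrix.rank_submatrix_le _ _ _

end RankAux

/-! ### App. B: the weak border completion rank of the example is `2` -/

section AppendixB

/-- The slices `A₁ = E₃₁`, `A₂ = E₃₂` are rank-one matrices `e₃ · e_kᵀ`.
[cite: BlaserIkenmeyerJindalLysikov2018, App. B] locator: ECCC p.26 -/
theorem appBSlices_eq_vecMulVec (k : Fin 2) :
    appBSlices K k = Matrix.vecMulVec (fun i : Fin 3 => if i = 2 then (1 : K) else 0)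
      (fun j : Fin 3 => if j.1 = k.1 then 1 else 0) := by
  ext i j
  simp only [appBSlices, Matrix.of_apply, Matrix.vecMulVec_apply, ite_zero_mul_ite_zero, mul_one]

/-- `rk A_k = 1 ≥`: the slices have rank at most one … [cite: BlaserIkenmeyerJindalLysikov2018, App. B] -/
theorem rank_appBSlices_le_one (k : Fin 2) : (appBSlices K k).rank ≤ 1 := by
  rw [appBSlices_eq_vecMulVec]
  exact Matrix.rank_vecMulVec_le _ _

/-- … and at least one. [cite: BlaserIkenmeyerJindalLysikov2018, App. B] -/
theorem one_le_rank_appBSlices (k : Fin 2) : 1 ≤ (appBSlices K k).rank :=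
  one_le_rank_of_apply_ne_zero (appBSlices K k) 2 ⟨k.1, by omega⟩ (by simp [appBSlices])

/-- "We can however bring down the rank to `2` by substituting `y ↦ 1/ε`": with
`Ã₀ = I₃ + εE₂₃ = I₃ + O(ε)` and `λ = (0, 1/ε)`, the matrix `Ã₀ + λ₁A₁ + λ₂A₂ =
[[1,0,0],[0,1,ε],[0,1/ε,1]]` has rank `≤ 2` (its last two rows are proportional).
[cite: BlaserIkenmeyerJindalLysikov2018, App. B] locator: ECCC p.26 -/
theorem appB_weak_witness :
    IsMatrixApproxOf (1 : Matrix (Fin 3) (Fin 3) K) !![1, 0, 0; 0, 1, RatFunc.X; 0, 0, 1] ∧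
      (pencilEval !![1, 0, 0; 0, 1, RatFunc.X; 0, 0, 1] (fun k => (appBSlices K k).map RatFunc.C)
        ![0, RatFunc.X⁻¹]).rank ≤ 2 := by
  constructor
  · intro i j
    fin_cases i <;> fin_cases j <;> simp [isApproxOf_one, isApproxOf_zero, isApproxOf_X]
  · have hM : pencilEval !![1, 0, 0; 0, 1, RatFunc.X; 0, 0, 1]
        (fun k => (appBSlices K k).map RatFunc.C) ![0, RatFunc.X⁻¹] =
        !![1, 0; 0, RatFunc.X; 0, 1] * !![1, 0, 0; 0, RatFunc.X⁻¹, 1] := by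
      ext i j
      fin_cases i <;> fin_cases j <;>
        simp [pencilEval, appBSlices, Fin.sum_univ_two, Matrix.mul_apply, RatFunc.X_ne_zero]
    rw [hM]
    exact (Matrix.rank_mul_le_left _ _).trans ((Matrix.rank_le_card_width _).trans (by simp))

/-- **App. B, first half: the weak border completion rank of `(I₃, E₃₁, E₃₂)` is `2`.** "No
matter how we substitute the variables, the upper-left `2 × 2`-minor of any close-enough
approximation to this matrix will be nonzero." [cite: BlaserIkenmeyerJindalLysikov2018, App. B]
locator: ECCC p.26 -/
theorem weakBorderCompletionRank_appB :
    weakBorderCompletionRank (1 : Matrix (Fin 3) (Fin 3) K) (appBSlices K) = 2 := by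
  obtain ⟨happ, hrk⟩ := appB_weak_witness (K := K)
  have hmem : (2 : ℕ) ∈ {r | ∃ (B₀ : Matrix (Fin 3) (Fin 3) (RatFunc K)) (c : Fin 2 → RatFunc K),
      IsMatrixApproxOf 1 B₀ ∧
        (pencilEval B₀ (fun k => (appBSlices K k).map RatFunc.C) c).rank ≤ r} :=
    ⟨_, _, happ, hrk⟩
  unfold weakBorderCompletionRank
  apply le_antisymm (Nat.sInf_le hmem)
  apply le_csInf ⟨2, hmem⟩
  rintro r ⟨B₀, c, hB, hr⟩
  have hsub : (pencilEval B₀ (fun k => (appBSlices K k).map RatFunc.C) c).submatrix ![0, 1] ![0, 1] =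
      B₀.submatrix ![0, 1] ![0, 1] := by
    ext i j
    fin_cases i <;> fin_cases j <;> simp [pencilEval, appBSlices]
  have hdet : IsApproxOf (1 : K) (B₀.submatrix ![0, 1] ![0, 1]).det := by
    have h := ((hB 0 0).mul (hB 1 1)).sub ((hB 0 1).mul (hB 1 0))
    rw [Matrix.det_fin_two]
    simpa using h
  have hunit : IsUnit ((pencilEval B₀ (fun k => (appBSlices K k).map RatFunc.C) c).submatrix
      ![0, 1] ![0, 1]) := by
    rw [Matrix.isUnit_iff_isUnit_det, hsub]
    exact isUnit_iff_ne_zero.mpr (hdet.ne_zero one_ne_zero)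
  calc 2 = ((pencilEval B₀ (fun k => (appBSlices K k).map RatFunc.C) c).submatrix
        ![0, 1] ![0, 1]).rank := by rw [Matrix.rank_of_isUnit _ hunit]; simp
    _ ≤ (pencilEval B₀ (fun k => (appBSlices K k).map RatFunc.C) c).rank :=
        Matrix.rank_submatrix_le _ _ _
    _ ≤ r := hr

/-! ### App. B: the border completion rank of the example is `1` -/

/-- "If we work with approximations to `A₁` and `A₂`, we can bring down the border completion
rank down to one": `Ã₀ = I₃`, `Ã₁ = εE₁₁ + E₃₁`, `Ã₂ = εE₂₂ + E₃₂` (rank one each),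
`λ = (−1/ε, −1/ε)`, and `Ã₀ + λ₁Ã₁ + λ₂Ã₂ = [[0,0,0],[0,0,0],[−1/ε,−1/ε,1]]` has rank `1`.
[cite: BlaserIkenmeyerJindalLysikov2018, App. B] locator: ECCC p.27 -/
theorem appB_border_witness :
    IsBorderWitness (1 : Matrix (Fin 3) (Fin 3) K) (appBSlices K) 1
      ((1 : Matrix (Fin 3) (Fin 3) K).map RatFunc.C)
      ![!![RatFunc.X, 0, 0; 0, 0, 0; 1, 0, 0], !![0, 0, 0; 0, RatFunc.X, 0; 0, 1, 0]]
      ![-RatFunc.X⁻¹, -RatFunc.X⁻¹] := by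
  refine ⟨isMatrixApproxOf_map_C 1, ?_, ?_, ?_, ?_⟩
  · intro k i j
    fin_cases k <;> fin_cases i <;> fin_cases j <;>
      simp [appBSlices, isApproxOf_one, isApproxOf_zero, isApproxOf_X]
  · rw [Matrix.rank_one]
    exact Matrix.rank_le_card_width _
  · intro k
    refine le_trans ?_ (one_le_rank_appBSlices k)
    fin_cases k
    · have h : !![RatFunc.X, 0, 0; 0, 0, 0; 1, 0, 0] =
          Matrix.vecMulVec ![RatFunc.X, 0, 1] ![(1 : RatFunc K), 0, 0] := by
        ext i j; fin_cases i <;> fin_cases j <;> simp [Matrix.vecMulVec_apply]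
      simp only [Fin.zero_eta, Matrix.cons_val_zero]
      rw [h]
      exact Matrix.rank_vecMulVec_le _ _
    · have h : !![0, 0, 0; 0, RatFunc.X, 0; 0, 1, 0] =
          Matrix.vecMulVec ![0, RatFunc.X, 1] ![(0 : RatFunc K), 1, 0] := by
        ext i j; fin_cases i <;> fin_cases j <;> simp [Matrix.vecMulVec_apply]
      simp only [Fin.mk_one, Matrix.cons_val_one, Matrix.cons_val_zero]
      rw [h]
      exact Matrix.rank_vecMulVec_le _ _
  · have hM : pencilEval ((1 : Matrix (Fin 3) (Fin 3) K).map RatFunc.C)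
        ![!![RatFunc.X, 0, 0; 0, 0, 0; 1, 0, 0], !![0, 0, 0; 0, RatFunc.X, 0; 0, 1, 0]]
        ![-RatFunc.X⁻¹, -RatFunc.X⁻¹] =
        Matrix.vecMulVec ![(0 : RatFunc K), 0, 1] ![-RatFunc.X⁻¹, -RatFunc.X⁻¹, 1] := by
      ext i j
      fin_cases i <;> fin_cases j <;>
        simp [pencilEval, Fin.sum_univ_two, Matrix.vecMulVec_apply, RatFunc.X_ne_zero]
    rw [hM]
    exact Matrix.rank_vecMulVec_le _ _

/-- **App. B, second half: `\underline{CR}(I₃, E₃₁, E₃₂) = 1`.** (Upper bound: the witness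
above; lower bound: `Ã₀ = I₃ + O(ε)` is invertible over `K(ε)`, while `λ₁Ã₁ + λ₂Ã₂` has rank
`≤ rk A₁ + rk A₂ = 2`.) [cite: BlaserIkenmeyerJindalLysikov2018, App. B] locator: ECCC p.27 -/
theorem borderCompletionRank_appB :
    borderCompletionRank (1 : Matrix (Fin 3) (Fin 3) K) (appBSlices K) = 1 := by
  apply le_antisymm (borderCompletionRank_le_of_isBorderWitness appB_border_witness)
  have hmem : (1 : ℕ) ∈ {r | ∃ (B₀ : Matrix (Fin 3) (Fin 3) (RatFunc K))
      (B : Fin 2 → Matrix (Fin 3) (Fin 3) (RatFunc K)) (c : Fin 2 → RatFunc K),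
      IsBorderWitness 1 (appBSlices K) r B₀ B c} :=
    ⟨_, _, _, appB_border_witness⟩
  unfold borderCompletionRank
  apply le_csInf ⟨1, hmem⟩
  rintro r ⟨B₀, B, c, hB₀, -, -, hBk, hr⟩
  have hdet : IsApproxOf (1 : K) B₀.det := by
    have h := fun i j => hB₀ i j
    have big := ((((((h 0 0).mul (h 1 1)).mul (h 2 2)).sub (((h 0 0).mul (h 1 2)).mul (h 2 1))).sub
      (((h 0 1).mul (h 1 0)).mul (h 2 2))).add (((h 0 1).mul (h 1 2)).mul (h 2 0))).add
      (((h 0 2).mul (h 1 0)).mul (h 2 1))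
    have big' := big.sub (((h 0 2).mul (h 1 1)).mul (h 2 0))
    rw [Matrix.det_fin_three]
    simpa [Matrix.one_apply] using big'
  have h3 : B₀.rank = 3 := by
    rw [Matrix.rank_of_isUnit _ ((Matrix.isUnit_iff_isUnit_det _).mpr
      (isUnit_iff_ne_zero.mpr (hdet.ne_zero one_ne_zero)))]
    simp
  have hk : ∀ k, ((-c k) • B k).rank ≤ 1 := fun k =>
    (rank_smul_le_aux _ _).trans ((hBk k).trans (rank_appBSlices_le_one k))
  have hsum : (∑ k, (-c k) • B k).rank ≤ 2 := by
    rw [Fin.sum_univ_two]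
    exact (rank_add_le_aux _ _).trans (Nat.add_le_add (hk 0) (hk 1))
  have heq : pencilEval B₀ B c + ∑ k, (-c k) • B k = B₀ := by
    rw [pencilEval, add_assoc, ← Finset.sum_add_distrib]
    simp [neg_smul]
  have hle : B₀.rank ≤ (pencilEval B₀ B c).rank + (∑ k, (-c k) • B k).rank := by
    conv_lhs => rw [← heq]
    exact rank_add_le_aux _ _
  omega

variable (K) in
/-- **BIJL App. B holds** (discharge of `BIJL2018_appB_example`): the two border completion ranks
differ on `(I₃, E₃₁, E₃₂)`. [cite: BlaserIkenmeyerJindalLysikov2018, App. B] locator: ECCC pp.26–27 -/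
theorem BIJL2018_appB_example_holds : BIJL2018_appB_example K :=
  ⟨weakBorderCompletionRank_appB, borderCompletionRank_appB⟩

end AppendixB

end Literature.Barriers.ValiantsHypothesis

end
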